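import Mathlib.Data.ZMod.Defs
import Mathlib.SetTheory.Cardinal.NatCard
import Literature.AnabelianGeometry.SemiGraphs.Pullback

/-!
# Zariski's Main Theorem for semi-graphs ([SemiAnbd] §1, Prop. 1.1 – Remark 1.5.1, pp. 14–19)

Mochizuki, *Semi-graphs of anabelioids*, Publ. RIMS **42** (2006) 221–322, §1, author's manuscript
pp. 14–19 [cite: MochizukiSemiAnbd2006, §1 pp.14-19].  Statements first: every printed claim is
a NAMED FACT (`def … : Prop`) unless proved here.

* Proposition 1.1 (an immersion from a connected graph into a tree is an embedding);
* Theorem 1.2 ("Zariski's Main Theorem for Semi-graphs") (i), (ii) — M. Matsumoto's theorem;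
* the graphs `H_n` (one vertex, `n` loops, p. 16), Lemma 1.3 (i)–(iii) (morphisms `G → H_n` =
  orientations + colourings; immersion / excision criteria), Lemma 1.4, Lemma 1.5;
* Remark 1.5.1 (the "nonarchimedean" `d ≡ 0 (mod n)` and "archimedean" `d ≥ n` conditions), with
  the cyclic coverings `C_d → H_1` and the path graphs it refers to.

Rendering notes.  (1) Lemma 1.3 (i) "is equivalent to assigning an orientation and a colour": an
orientation of an edge `e` of `G` is a bijection of its set of branches with `Bool` (`true` = the
branch that "leaves").  (2) Remarks 1.2.1 (attribution to M. Matsumoto) and 1.2.2 (analogy with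
Zariski's Main Theorem for schemes, [Milne] I.1.8) are prose; recorded here only.  (3) "Connected
component of `G_A'`" in Theorem 1.2 (ii) is rendered "connected sub-semi-graph of `G_A'`" (an
embedding restricts to embeddings, so this is equivalent).

Deliberately NOT here: universal graph-coverings and the discussion of p. 15 (topological); the
pull-back itself (`Pullback.lean`); Corollaries 1.6, 1.7 and Lemma 1.8 (`FreeGroupsAndActions.lean`).
-/

namespace Literature.AnabelianGeometry.SemiGraphs

namespace SemiGraph

open CategoryTheory

universe u

/-! ### Proposition 1.1 and Theorem 1.2 (pp. 14–16) -/

/-- NAMED FACT, [SemiAnbd] Proposition 1.1: "Any immersion from a connected graph into a tree is,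
in fact, an embedding." [cite: MochizukiSemiAnbd2006, Prop. 1.1 p.14] -/
def immersion_into_tree_isEmbedding : Prop :=
  ∀ (A B : SemiGraph.{u}) (φ : A ⟶ B), A.IsGraph → A.IsConnected → B.IsTree →
    IsImmersion φ → IsEmbedding φ

/-- NAMED FACT, [SemiAnbd] Theorem 1.2 (i) ("Zariski's Main Theorem for Semi-graphs", proof by
M. Matsumoto, Remark 1.2.1): an immersion `φ : G_A → G_B` of finite semi-graphs "factors as the
composite of an embedding `G_A ↪ G_B'` and a finite graph-covering `G_B' → G_B`."
[cite: MochizukiSemiAnbd2006, Thm. 1.2(i) p.15] -/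
def zariskiMainTheorem_factorization : Prop :=
  ∀ (A B : SemiGraph.{u}) (φ : A ⟶ B), A.IsFinite → B.IsFinite → IsImmersion φ →
    ∃ (B' : SemiGraph.{u}) (ι : A ⟶ B') (π : B' ⟶ B),
      IsEmbedding ι ∧ IsFiniteGraphCovering π ∧ ι ≫ π = φ

/-- NAMED FACT, [SemiAnbd] Theorem 1.2 (ii): for an immersion `φ : G_A → G_B` of finite semi-graphs
"there exists a finite graph-covering `G_B' → G_B` such that the restriction of the base-changed
morphism `φ' : G_A' → G_B'` to each connected component of `G_A'` is an embedding" — a connected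
component being rendered as a connected sub-semi-graph, so: the restriction of `φ'` to every
connected sub-semi-graph of `G_A' = G_A ×_{G_B} G_B'` is an embedding.
[cite: MochizukiSemiAnbd2006, Thm. 1.2(ii) p.15] -/
def zariskiMainTheorem_baseChange : Prop :=
  ∀ (A B : SemiGraph.{u}) (φ : A ⟶ B), A.IsFinite → B.IsFinite → IsImmersion φ →
    ∃ (B' : SemiGraph.{u}) (π : B' ⟶ B), IsFiniteGraphCovering π ∧
      ∀ H : (pullback φ π).Subgraph, H.toSemiGraph.IsConnected →
        IsEmbedding (H.ι ≫ pullback.snd φ π)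

/-! ### The graphs `H_n` and Lemmas 1.3–1.5 (pp. 16–18) -/

/-- `H_n` (p. 16): "the graph consisting of one vertex `v_H` and `n` edges `e_{H,1}, …, e_{H,n}` (all
of which run from `v_H` to `v_H`)"; the two branches of `e_{H,i}` are `(i, false)` and `(i, true)`.
[cite: MochizukiSemiAnbd2006, §1 p.16] -/
def bouquet (n : ℕ) : SemiGraph.{u} where
  Vertex := PUnit
  Edge := ULift (Fin n)
  Branch := ULift (Fin n × Bool)
  edgeOf b := ⟨b.down.1⟩
  abuts _ := some PUnit.unit
  two_branches e := by
    refine ⟨⟨(e.down, false)⟩, ⟨(e.down, true)⟩, fun h => ?_, rfl, rfl, fun b hb => ?_⟩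
    · cases h
    · have h1 : b.down.1 = e.down := congrArg ULift.down hb
      rcases hbool : b.down.2 with _ | _
      · left; exact congrArg ULift.up (Prod.ext h1 hbool)
      · right; exact congrArg ULift.up (Prod.ext h1 hbool)

/-- `H_n` is a graph: every branch abuts to `v_H` ("the vertex `v_H` of the graph `H_n` meets precisely
`2n` branches", p. 16). [cite: MochizukiSemiAnbd2006, §1 p.16] -/
theorem bouquet_isGraph (n : ℕ) : (bouquet.{u} n).IsGraph := ⟨fun _ => rfl⟩

/-- An *orientation* of the edges of `G` (Lemma 1.3: "assigning an orientation … to each edge"): for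
each edge a bijection of its two branches with `Bool` (`true` = the branch that leaves).
[cite: MochizukiSemiAnbd2006, Lem. 1.3(i) p.17] -/
def Orientation (G : SemiGraph.{u}) : Type u := ∀ e : G.Edge, {b : G.Branch // G.edgeOf b = e} ≃ Bool

/-- A *colouring* of the edges of `G` by `n` colours (Lemma 1.3: "a “color” `∈ {1, …, n}` to each
edge"). [cite: MochizukiSemiAnbd2006, Lem. 1.3(i) p.17] -/
def Coloring (G : SemiGraph.{u}) (n : ℕ) : Type u := G.Edge → ULift.{u} (Fin n)

/-- The morphism `G → H_n` determined by an orientation and a colouring (proof of Lemma 1.3 (i):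
"sending all the vertices of `G` to `v_H` and mapping the edges of `G` to the edges of `H_n` in the
unique way which preserves orientations and colors"). [cite: MochizukiSemiAnbd2006, Lem. 1.3(i) p.17] -/
def toBouquet {G : SemiGraph.{u}} {n : ℕ} (o : G.Orientation) (c : G.Coloring n) : G ⟶ bouquet n where
  vertexMap _ := PUnit.unit
  edgeMap e := c e
  branchMap b := ⟨((c (G.edgeOf b)).down, o (G.edgeOf b) ⟨b, rfl⟩)⟩
  edgeOf_branchMap _ := rfl
  branchMap_injOn b₁ b₂ he h := by
    have key : ∀ (e₁ e₂ : G.Edge) (hx : e₁ = e₂) (x : {b // G.edgeOf b = e₁})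
        (y : {b // G.edgeOf b = e₂}), o e₁ x = o e₂ y → x.1 = y.1 := by
      intro e₁ e₂ hx x y hxy
      subst hx
      exact congrArg Subtype.val ((o e₁).injective hxy)
    exact key _ _ he ⟨b₁, rfl⟩ ⟨b₂, rfl⟩ (congrArg (fun x : ULift (Fin n × Bool) => x.down.2) h)
  abuts_branchMap _ _ _ := rfl

/-- NAMED FACT, [SemiAnbd] Lemma 1.3 (i): for a finite graph `G`, "to give a morphism `φ : G → H_n` is
equivalent to assigning an orientation and a “color” `∈ {1, …, n}` to each edge of `G`" — the map
`toBouquet` is a bijection. [cite: MochizukiSemiAnbd2006, Lem. 1.3(i) p.17] -/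
def lemma_1_3_i : Prop :=
  ∀ (G : SemiGraph.{u}) (n : ℕ), G.IsFinite → G.IsGraph →
    Function.Bijective (fun p : G.Orientation × G.Coloring n => toBouquet p.1 p.2)

/-- The number of branches of colour `i` at the vertex `v` that leave (`dir = true`) resp. enter
(`dir = false`) `v`, relative to `φ : G → H_n` (Lemma 1.3 (ii),(iii)).
[cite: MochizukiSemiAnbd2006, Lem. 1.3(ii) p.17] -/
noncomputable def colourDegree {G : SemiGraph.{u}} {n : ℕ} (φ : G ⟶ bouquet n) (v : G.Vertex)
    (i : Fin n) (dir : Bool) : ℕ :=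
  Nat.card {b : G.Star v // (φ.branchMap b.1).down = (i, dir)}

/-- [SemiAnbd] Lemma 1.3 (ii): "`φ` is an immersion if and only if for each color `i` and at each
vertex `v` of `G`, the number of branches of color `i` that enter (respectively, leave) `v` is `≤ 1`"
(finite graph `G`). PROVED from the definitions. [cite: MochizukiSemiAnbd2006, Lem. 1.3(ii) p.17] -/
theorem lemma_1_3_ii {G : SemiGraph.{u}} {n : ℕ} (hG : G.IsFinite) (φ : G ⟶ bouquet n) :
    IsImmersion φ ↔ ∀ (v : G.Vertex) (i : Fin n) (dir : Bool), colourDegree φ v i dir ≤ 1 := by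
  classical
  have hfin : ∀ v : G.Vertex, Finite (G.Star v) := by
    intro v
    haveI := hG.finite_edge
    have : Finite {e : G.Edge | G.EdgeAbuts e v} := Subtype.finite
    let f : G.Star v → {e : G.Edge | G.EdgeAbuts e v} × Bool := fun b =>
      (⟨G.edgeOf b.1, b.1, rfl, b.2⟩, (φ.branchMap b.1).down.2)
    refine Finite.of_injective f fun b₁ b₂ h => ?_
    have he : G.edgeOf b₁.1 = G.edgeOf b₂.1 := congrArg (fun x => x.1.1) h
    have hd : (φ.branchMap b₁.1).down.2 = (φ.branchMap b₂.1).down.2 := congrArg (fun x => x.2) h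
    have h1 : (φ.branchMap b₁.1).down.1 = (φ.branchMap b₂.1).down.1 := by
      have e1 := congrArg ULift.down (φ.edgeOf_branchMap b₁.1)
      have e2 := congrArg ULift.down (φ.edgeOf_branchMap b₂.1)
      exact e1.trans ((congrArg (fun e => (φ.edgeMap e).down) he).trans e2.symm)
    exact Subtype.ext (φ.branchMap_injOn _ _ he (congrArg ULift.up (Prod.ext h1 hd)))
  constructor
  · intro hφ v i dir
    haveI := hfin v
    rw [colourDegree, Finite.card_le_one_iff_subsingleton]
    refine ⟨fun x y => Subtype.ext (hφ v (Subtype.ext ?_))⟩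
    exact congrArg ULift.up (x.2.trans y.2.symm)
  · intro h v x y hxy
    have hval : φ.branchMap x.1 = φ.branchMap y.1 := congrArg Subtype.val hxy
    haveI := hfin v
    have hc := h v (φ.branchMap x.1).down.1 (φ.branchMap x.1).down.2
    rw [colourDegree, Finite.card_le_one_iff_subsingleton] at hc
    have := hc.elim ⟨x, rfl⟩ ⟨y, by rw [← hval]⟩
    exact congrArg Subtype.val this

/-- [SemiAnbd] Lemma 1.3 (iii): "`φ` is an excision [or, equivalently, a finite graph-covering] if and
only if for each color `i` and at each vertex `v` of `G`, the number of branches of color `i` that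
enter (respectively, leave) `v` is `= 1`" (finite graph `G`) — the excision clause, as a NAMED FACT;
the bracket "[or, equivalently, a finite graph-covering]" is `lemma_1_3_iii'`.
[cite: MochizukiSemiAnbd2006, Lem. 1.3(iii) p.17] -/
def lemma_1_3_iii : Prop :=
  ∀ (G : SemiGraph.{u}) (n : ℕ) (φ : G ⟶ bouquet n), G.IsFinite → G.IsGraph →
    (IsExcision φ ↔ ∀ (v : G.Vertex) (i : Fin n) (dir : Bool), colourDegree φ v i dir = 1)

/-- NAMED FACT ([SemiAnbd] proof of Lemma 1.3, p. 17): "a morphism of finite graphs is always proper,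
hence is a finite graph-covering if and only if it is excisive".
[cite: MochizukiSemiAnbd2006, Lem. 1.3(iii) p.17] -/
def lemma_1_3_iii' : Prop :=
  ∀ (G G' : SemiGraph.{u}) (φ : G ⟶ G'), G.IsFinite → G.IsGraph → G'.IsFinite → G'.IsGraph →
    IsProper φ ∧ (IsFiniteGraphCovering φ ↔ IsExcision φ)

/-- NAMED FACT, [SemiAnbd] Lemma 1.4: "Every finite graph `G` admits an immersion `G → H_n` for some
integer `n ≥ 1`." [cite: MochizukiSemiAnbd2006, Lem. 1.4 p.17] -/
def lemma_1_4 : Prop :=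
  ∀ G : SemiGraph.{u}, G.IsFinite → G.IsGraph → ∃ n ≥ 1, ∃ φ : G ⟶ bouquet n, IsImmersion φ

/-- NAMED FACT, [SemiAnbd] Lemma 1.5: an immersion `φ : G → H_n` of finite graphs "extends to a finite
graph-covering `φ' : G' → H_n` for some embedding `G ↪ G'`."
[cite: MochizukiSemiAnbd2006, Lem. 1.5 p.17] -/
def lemma_1_5 : Prop :=
  ∀ (G : SemiGraph.{u}) (n : ℕ) (φ : G ⟶ bouquet n), G.IsFinite → G.IsGraph → IsImmersion φ →
    ∃ (G' : SemiGraph.{u}) (ι : G ⟶ G') (φ' : G' ⟶ bouquet n),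
      G'.IsFinite ∧ IsEmbedding ι ∧ IsFiniteGraphCovering φ' ∧ ι ≫ φ' = φ

/-! ### Remark 1.5.1 (pp. 18–19) -/

/-- The connected finite graph-covering `C_d → H_1` of degree `d ≥ 1` (Remark 1.5.1: "the isomorphism
class of a (connected) finite graph-covering `G' → H_1` of `H_1` is determined by its degree `d`"):
the `d`-cycle, vertices and edges indexed by `ZMod d`, the edge `j` running from `j` to `j + 1`.
[cite: MochizukiSemiAnbd2006, Rem. 1.5.1 p.18] -/
def cycleCover (d : ℕ) : SemiGraph.{u} where
  Vertex := ULift (ZMod d)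
  Edge := ULift (ZMod d)
  Branch := ULift (ZMod d × Bool)
  edgeOf b := ⟨b.down.1⟩
  abuts b := some ⟨if b.down.2 then b.down.1 else b.down.1 + 1⟩
  two_branches e := by
    refine ⟨⟨(e.down, false)⟩, ⟨(e.down, true)⟩, fun h => ?_, rfl, rfl, fun b hb => ?_⟩
    · cases h
    · have h1 : b.down.1 = e.down := congrArg ULift.down hb
      rcases hbool : b.down.2 with _ | _
      · left; exact congrArg ULift.up (Prod.ext h1 hbool)
      · right; exact congrArg ULift.up (Prod.ext h1 hbool)

/-- The structure morphism `C_d → H_1` (the branch `(j, true)` leaves `j`, `(j, false)` enters `j + 1`).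
[cite: MochizukiSemiAnbd2006, Rem. 1.5.1 p.18] -/
def cycleCoverHom (d : ℕ) : cycleCover.{u} d ⟶ bouquet.{u} 1 where
  vertexMap _ := PUnit.unit
  edgeMap _ := ⟨0⟩
  branchMap b := ⟨(0, b.down.2)⟩
  edgeOf_branchMap _ := rfl
  branchMap_injOn b₁ b₂ he h := by
    have h1 : b₁.down.1 = b₂.down.1 := congrArg ULift.down he
    have h2 : b₁.down.2 = b₂.down.2 := congrArg (fun x : ULift (Fin 1 × Bool) => x.down.2) h
    exact congrArg ULift.up (Prod.ext h1 h2)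
  abuts_branchMap _ _ _ := rfl

/-- The path graph `P_n` of Remark 1.5.1 (2): "`n` vertices `v_1, …, v_n`, and precisely one edge
joining `v_j` to `v_{j+1}`, for `j = 1, …, n − 1` (and no other edges)"; the edge `j` has branches
`(j, true)` at `v_j` and `(j, false)` at `v_{j+1}`. [cite: MochizukiSemiAnbd2006, Rem. 1.5.1 p.19] -/
def pathGraph (n : ℕ) : SemiGraph.{u} where
  Vertex := ULift (Fin n)
  Edge := ULift {j : Fin n // j.1 + 1 < n}
  Branch := ULift ({j : Fin n // j.1 + 1 < n} × Bool)
  edgeOf b := ⟨b.down.1⟩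
  abuts b := some ⟨if b.down.2 then b.down.1.1 else ⟨b.down.1.1.1 + 1, b.down.1.2⟩⟩
  two_branches e := by
    refine ⟨⟨(e.down, false)⟩, ⟨(e.down, true)⟩, fun h => ?_, rfl, rfl, fun b hb => ?_⟩
    · cases h
    · have h1 : b.down.1 = e.down := congrArg ULift.down hb
      rcases hbool : b.down.2 with _ | _
      · left; exact congrArg ULift.up (Prod.ext h1 hbool)
      · right; exact congrArg ULift.up (Prod.ext h1 hbool)

/-- The immersion `P_n → H_1` of Remark 1.5.1 (2) (all edges oriented from `v_j` to `v_{j+1}`).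
[cite: MochizukiSemiAnbd2006, Rem. 1.5.1 p.19] -/
def pathGraphHom (n : ℕ) : pathGraph.{u} n ⟶ bouquet.{u} 1 where
  vertexMap _ := PUnit.unit
  edgeMap _ := ⟨0⟩
  branchMap b := ⟨(0, b.down.2)⟩
  edgeOf_branchMap _ := rfl
  branchMap_injOn b₁ b₂ he h := by
    have h1 : b₁.down.1 = b₂.down.1 := congrArg ULift.down he
    have h2 : b₁.down.2 = b₂.down.2 := congrArg (fun x : ULift (Fin 1 × Bool) => x.down.2) h
    exact congrArg ULift.up (Prod.ext h1 h2)
  abuts_branchMap _ _ _ := rfl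

/-- The property asked for in Remark 1.5.1 of a finite graph-covering of `H_1`, relative to a given
`φ : G → H_1`: "the property of Theorem 1.2, (ii)" — every connected sub-semi-graph of the base
change `G ×_{H_1} C_d` embeds into `C_d`. [cite: MochizukiSemiAnbd2006, Rem. 1.5.1 p.18] -/
def HasZMTProperty {G : SemiGraph.{u}} (φ : G ⟶ bouquet.{u} 1) (d : ℕ) : Prop :=
  ∀ H : (pullback φ (cycleCoverHom d)).Subgraph, H.toSemiGraph.IsConnected →
    IsEmbedding (H.ι ≫ pullback.snd φ (cycleCoverHom d))

/-- NAMED FACT, [SemiAnbd] Remark 1.5.1 (1): if `φ : G → H_1` (with `G` finite connected) "is itself a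
finite graph-covering, of degree `n`", then the degree-`d` covering `C_d → H_1` has the property of
Theorem 1.2 (ii) iff the "nonarchimedean" condition `d ≡ 0 (mod n)` holds.
[cite: MochizukiSemiAnbd2006, Rem. 1.5.1(1) p.19] -/
def remark_1_5_1_nonarchimedean : Prop :=
  ∀ (G : SemiGraph.{u}) (φ : G ⟶ bouquet.{u} 1) (n d : ℕ), 1 ≤ n → 1 ≤ d → G.IsConnected →
    IsFiniteGraphCovering φ → Nat.card G.Vertex = n → (HasZMTProperty φ d ↔ n ∣ d)

/-- NAMED FACT, [SemiAnbd] Remark 1.5.1 (2): for the path `P_n → H_1` the degree-`d` covering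
`C_d → H_1` has the property of Theorem 1.2 (ii) iff the "archimedean" condition `d ≥ n` holds.
[cite: MochizukiSemiAnbd2006, Rem. 1.5.1(2) p.19] -/
def remark_1_5_1_archimedean : Prop :=
  ∀ n d : ℕ, 1 ≤ n → 1 ≤ d → (HasZMTProperty (pathGraphHom.{u} n) d ↔ n ≤ d)

end SemiGraph

end Literature.AnabelianGeometry.SemiGraphs
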